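import Literature.Computability.Complexity.IrreducibilityLLLCriterion
import HarnessLib

/-!
# The degree of the irreducible factor through a `p`-adic factor is read off one LLL reduction
# (LLL 1982, Prop. (2.13), general `m`)

Support file for the discharge of the named fact
`Literature.Computability.Complexity.lenstra_numberFieldIso_mem_P` (isomorphism of the number
fields defined by two monic irreducible integer polynomials is decidable in `P`; A. K. Lenstra
1983, Landau 1985, Cohen GTM 138 §4.5.4). After Trager's norm reduction
(`NumberFieldIsomorphismProofs.lean`, `nfIsomorphic_iff_of_norm_values`) the decision is: does a
monic squarefree `N ∈ ℤ[X]` of degree `D` have an irreducible factor of degree `≤ m` (for some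
`m < D`)? This file proves the lattice criterion that answers it, the GENERAL case of LLL82
Prop. (2.13) ("`deg h₀ ≤ m` iff the first reduced vector is short"), on the infrastructure of the
sibling files `IrreducibilityLLLResultant.lean` / `IrreducibilityLLLCriterion.lean` (which prove
the special case `m = D - 1`, i.e. the irreducibility test, for the companion fact
`lll_monicIrreducible_mem_P`):

* `degTestBound m S = 2^m · ((m+1)·4^m·S)` and
  `degPrecisionBound m D S = (degTestBound m S)^D · ((D+1)·4^D·S)^m`;
* `exists_monic_irreducible_factor_of_map_dvd` — the factor `h₀` of LLL82 (2.5): a monic `N` whose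
  reduction is divisible by the irreducible `ū` has a monic irreducible factor `h₀` with `ū ∣ h̄₀`;
* **`exists_factor_le_iff_firstRow_le`** — for `N` monic of degree `D`, `p` prime with `N mod p`
  squarefree, `u` monic of degree `d` with `0 < d ≤ m < D`, `ū` irreducible, `u ∣ N (mod p^k)` and
  `degPrecisionBound m D |N|² < p^{2k}`: `N` has a monic irreducible factor `g` with `ū ∣ ḡ` and
  `deg g ≤ m` iff `Σⱼ b₁ⱼ² ≤ degTestBound m |N|²`, where `b₁` is the first row of
  `lllReduce (factorInstance (m+1) d u p^k)` (the lattice of LLL82 (2.3) of polynomials of degree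
  `≤ m` divisible by `u` modulo `p^k`). (⇐: the first row is a nonzero `g ∈ L` with
  `|g|^{deg h₀} |h₀|^{deg g} < p^k`, so `h₀ ∣ g` by `natDegree_le_of_irreducible_of_modDvd` applied to
  `h₀`, whence `deg h₀ ≤ m`; ⇒: such a `g` lies in `L` by `modDvd_of_modDvd_mul_of_isCoprime` and is
  short by Mignotte, so `b₁` is short by LLL82 Prop. (1.11).)
* `natDegree_le_of_map_dvd` — if `d > m` the answer is "no" without any lattice;
* `exists_irreducible_dvd_map_rat_iff` — the question over `ℚ` (as `nfIsomorphic_iff_of_norm_values`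
  asks it) is the question over `ℤ` for monic integer irreducible factors (Gauss's lemma).

## References

* A. K. Lenstra, H. W. Lenstra Jr., L. Lovász, *Factoring polynomials with rational coefficients*,
  Math. Ann. 261 (1982) 515–534: (2.3), Prop. (2.5)–(2.7), Prop. (2.13) ("`deg(h₀) ≤ m` if and only
  if `|b₁| < (p^{kl}/|f|^m)^{1/n}`"), (3.1)–(3.5). [LenstraLenstraLovasz1982]
* A. K. Lenstra, *Factoring polynomials over algebraic number fields*, EUROCAL '83, LNCS 162 (1983)
  245–254 = MC report IW 213/82, §2 (2.13) and §3 (3.1)–(3.3) (the same lattice test drives the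
  factorisation over `ℚ(α)`; here it is applied to the norm polynomial over `ℚ`). [Lenstra1983]
* M. R. Bremner, *Lattice Basis Reduction*, CRC Press 2011, §15.7. [Bremner2011]
-/

noncomputable section

open Polynomial Finset Module Literature.Algebra.EuclideanLattices

namespace Literature.Computability.Complexity

namespace LLLFactoring

/-! ### The thresholds -/

/-- The threshold `2^m · ((m+1)·4^m·S)` compared with `|b₁|²` (`S = |N|²`; `(m+1)·4^m·|N|²` bounds
`|g|²` for every factor `g` of `N` of degree `≤ m`, Mignotte; `2^m` is the LLL loss in dimension
`m + 1`). [cite: LenstraLenstraLovasz1982, Prop. (2.13) and (3.3)–(3.5)] -/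
def degTestBound (m : ℕ) (S : ℤ) : ℤ := 2 ^ m * ((m + 1) * 4 ^ m * S)

/-- The precision the modulus must exceed: `p^{2k} > (degTestBound m S)^D · ((D+1)·4^D·S)^m`
(LLL82 (2.14): `p^{kl} > 2^{mn/2} (2m choose m)^{n/2} |f|^{m+n}`, squared and with the cruder
Mignotte constant). [cite: LenstraLenstraLovasz1982, (2.14) and (3.3)] -/
def degPrecisionBound (m D : ℕ) (S : ℤ) : ℤ := degTestBound m S ^ D * ((D + 1) * 4 ^ D * S) ^ m

/-- `degTestBound m S ≥ 0` for `S ≥ 0`. [folklore] -/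
theorem degTestBound_nonneg (m : ℕ) {S : ℤ} (hS : 0 ≤ S) : 0 ≤ degTestBound m S := by
  unfold degTestBound; positivity

/-- `degTestBound m S ≥ 1` for `S ≥ 1`. [folklore] -/
theorem one_le_degTestBound (m : ℕ) {S : ℤ} (hS : 1 ≤ S) : 1 ≤ degTestBound m S := by
  unfold degTestBound
  have h1 : (1 : ℤ) ≤ 2 ^ m := one_le_pow₀ (by norm_num)
  have h2 : (1 : ℤ) ≤ 4 ^ m := one_le_pow₀ (by norm_num)
  have h3 : (1 : ℤ) ≤ (m + 1) := by exact_mod_cast Nat.succ_pos m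
  calc (1 : ℤ) = 1 * (1 * 1 * 1) := by ring
    _ ≤ 2 ^ m * ((m + 1) * 4 ^ m * S) := by gcongr

/-- The Mignotte constant is `≥ 1` for `S ≥ 1`. [folklore] -/
theorem one_le_mignotteConst (D : ℕ) {S : ℤ} (hS : 1 ≤ S) : (1 : ℤ) ≤ (D + 1) * 4 ^ D * S := by
  have h2 : (1 : ℤ) ≤ 4 ^ D := one_le_pow₀ (by norm_num)
  have h3 : (1 : ℤ) ≤ (D + 1) := by exact_mod_cast Nat.succ_pos D
  calc (1 : ℤ) = 1 * 1 * 1 := by ring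
    _ ≤ (D + 1) * 4 ^ D * S := by gcongr

/-! ### The factor `h₀` -/

/-- **The factor `h₀` of LLL82 (2.5).** If `N ∈ ℤ[X]` is monic, `N ≠ 1`, and the reduction modulo `p`
of `N` is divisible by the prime `ū = u mod p`, then `N` has a monic irreducible factor `h₀` whose
reduction is divisible by `ū`. [cite: LenstraLenstraLovasz1982, Prop. (2.5)] -/
theorem exists_monic_irreducible_factor_of_map_dvd {p : ℕ} {u : ℤ[X]}
    (hprime : Prime (u.map (Int.castRingHom (ZMod p)))) :
    ∀ (n : ℕ) (N : ℤ[X]), N.natDegree ≤ n → N.Monic → N ≠ 1 →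
      u.map (Int.castRingHom (ZMod p)) ∣ N.map (Int.castRingHom (ZMod p)) →
      ∃ h : ℤ[X], h.Monic ∧ Irreducible h ∧ h ∣ N ∧
        u.map (Int.castRingHom (ZMod p)) ∣ h.map (Int.castRingHom (ZMod p)) := by
  set φ := Int.castRingHom (ZMod p)
  intro n
  induction n with
  | zero =>
    intro N hNn hN hN1 _
    exact absurd (eq_one_of_monic_natDegree_zero hN (Nat.le_zero.1 hNn)) hN1
  | succ n ih =>
    intro N hNn hN hN1 hdvd
    by_cases hirr : Irreducible N
    · exact ⟨N, hN, hirr, dvd_rfl, hdvd⟩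
    · rw [irreducible_of_monic hN hN1] at hirr
      push Not at hirr
      obtain ⟨a, b, ha, hb, hab, ha1, hb1⟩ := hirr
      have hapos : 0 < a.natDegree := by
        by_contra h0
        exact ha1 (eq_one_of_monic_natDegree_zero ha (Nat.le_zero.1 (not_lt.1 h0)))
      have hbpos : 0 < b.natDegree := by
        by_contra h0
        exact hb1 (eq_one_of_monic_natDegree_zero hb (Nat.le_zero.1 (not_lt.1 h0)))
      have hdeg : a.natDegree + b.natDegree = N.natDegree := by rw [← hab, ha.natDegree_mul hb]
      have hdvdab : u.map φ ∣ a.map φ * b.map φ := by rw [← Polynomial.map_mul, hab]; exact hdvd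
      rcases hprime.dvd_or_dvd hdvdab with h | h
      · obtain ⟨h₀, hm, hi, hd, hu⟩ := ih a (by omega) ha ha1 h
        exact ⟨h₀, hm, hi, hd.trans ⟨b, hab.symm⟩, hu⟩
      · obtain ⟨h₀, hm, hi, hd, hu⟩ := ih b (by omega) hb hb1 h
        exact ⟨h₀, hm, hi, hd.trans ⟨a, by rw [mul_comm, hab]⟩, hu⟩

/-- If `ū ∣ ḡ` for a monic `g`, then `deg u ≤ deg g` (`u` monic). So a `p`-adic factor of degree
`d > m` lies under no factor of degree `≤ m`. [folklore] -/
theorem natDegree_le_of_map_dvd {p : ℕ} [Fact p.Prime] {u g : ℤ[X]} (hu : u.Monic) (hg : g.Monic)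
    (h : u.map (Int.castRingHom (ZMod p)) ∣ g.map (Int.castRingHom (ZMod p))) :
    u.natDegree ≤ g.natDegree := by
  set φ := Int.castRingHom (ZMod p)
  have := natDegree_le_of_dvd h (hg.map φ).ne_zero
  rwa [hu.natDegree_map, hg.natDegree_map] at this

/-! ### The criterion -/

variable {N u : ℤ[X]} {p k d m D : ℕ}

/-- **LLL82 Prop. (2.13), general form: the degree of the irreducible factor through `ū` is read
off the first LLL-reduced vector.** Let `N ∈ ℤ[X]` be monic of degree `D`, `p` a prime with
`N mod p` squarefree, `u ∈ ℤ[X]` monic of degree `d` with `0 < d ≤ m < D`, `ū = u mod p`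
irreducible, `u ∣ N (mod p^k)`, and `degPrecisionBound m D |N|² < p^{2k}`. Let `b₁` be the first
row of the LLL-reduced basis `lllReduce (factorInstance (m+1) d u p^k)` of
`L = {g : deg g ≤ m, u ∣ g mod p^k}`. Then `N` has a monic irreducible factor `g` with `ū ∣ ḡ` and
`deg g ≤ m` (i.e. `deg h₀ ≤ m` for the factor `h₀` of (2.5)) iff `Σⱼ b₁ⱼ² ≤ degTestBound m |N|²`.
[cite: LenstraLenstraLovasz1982, Prop. (2.13)] [cite: Lenstra1983, (2.13) and (3.1)–(3.3)] [cite: Bremner2011, §15.7] -/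
theorem exists_factor_le_iff_firstRow_le (hp : p.Prime) (hk : 0 < k) (hN : N.Monic)
    (hND : N.natDegree = D) (hu : u.Monic) (hud : u.natDegree = d) (hd : 0 < d) (hdm : d ≤ m)
    (hmD : m < D) (hirr : Irreducible (u.map (Int.castRingHom (ZMod p))))
    (hsq : Squarefree (N.map (Int.castRingHom (ZMod p))))
    (hNu : ModDvd (p ^ k) u N)
    (hK : degPrecisionBound m D (sqNorm N) < ((p ^ k : ℕ) : ℤ) ^ 2) :
    (∃ g : ℤ[X], g.Monic ∧ Irreducible g ∧ g ∣ N ∧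
        u.map (Int.castRingHom (ZMod p)) ∣ g.map (Int.castRingHom (ZMod p)) ∧ g.natDegree ≤ m) ↔
      ∑ j, (factorInstance (m + 1) d u (p ^ k)).lllReduce.basis ⟨0, Nat.succ_pos m⟩ j ^ 2 ≤
        degTestBound m (sqNorm N) := by
  haveI : Fact p.Prime := ⟨hp⟩
  set φ := Int.castRingHom (ZMod p) with hφ
  set M : ℕ := p ^ k with hM
  set I := factorInstance (m + 1) d u M with hIdef
  have hM2 : 2 ≤ M := by
    rw [hM]; exact le_trans hp.two_le (Nat.le_self_pow hk.ne' p)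
  have hM0 : M ≠ 0 := by omega
  have hI : I.IsNonsingular := isNonsingular_factorInstance hu hud (by omega) hM0
  have hIn : I.n ≠ 0 := by show m + 1 ≠ 0; omega
  have hN0 : N ≠ 0 := hN.ne_zero
  have hS1 : 1 ≤ sqNorm N := one_le_sqNorm_of_monic hN
  have hS0 : 0 ≤ sqNorm N := sqNorm_nonneg N
  have hu0 : 0 < u.natDegree := hud ▸ hd
  set b₁ : Fin (m + 1) → ℤ := I.lllReduce.basis ⟨0, Nat.succ_pos m⟩ with hb₁
  set B : ℤ := ∑ j, b₁ j ^ 2 with hB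
  change _ ↔ B ≤ degTestBound m (sqNorm N)
  -- `ū ∣ N̄`
  have hubarN : u.map φ ∣ N.map φ := by
    obtain ⟨v, hv⟩ := (hNu.of_modulus_dvd_modulus (dvd_pow_self p hk.ne')).exists_map_eq
    exact ⟨v.map φ, hv⟩
  -- the cofactor of a factor `g` with `ū ∣ ḡ` is coprime to `ū`, so `u ∣ g (mod p^k)`
  have cofactor : ∀ g w : ℤ[X], g * w = N → u.map φ ∣ g.map φ → ModDvd M u g := by
    intro g w hgw hug
    have hcop : IsCoprime (u.map φ) (w.map φ) := by
      rw [hirr.coprime_iff_not_dvd]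
      intro huw
      have hsq2 : u.map φ * u.map φ ∣ N.map φ := by
        rw [← hgw, Polynomial.map_mul]; exact mul_dvd_mul hug huw
      exact hirr.not_isUnit (hsq _ hsq2)
    exact modDvd_of_modDvd_mul_of_isCoprime (q := p) (k := k) (by rw [hgw]; exact hNu) hcop
  -- the first row as a polynomial `g ∈ L`
  have hrow_mem : I.lllReduce.vec ⟨0, Nat.succ_pos m⟩ ∈ I.lattice := by
    rw [← I.lllReduce_lattice]
    show I.lllReduce.vec ⟨0, Nat.succ_pos m⟩ ∈ Submodule.span ℤ (Set.range I.lllReduce.vec)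
    exact Submodule.subset_span ⟨_, rfl⟩
  obtain ⟨g, hgn, hgmod, hgvec⟩ := exists_poly_of_mem_lattice hu hud (Nat.succ_pos m) hrow_mem
  have hgb : toVec (m + 1) g = b₁ := intVecToEuclidean_injective (m + 1) hgvec
  have hBg : B = sqNorm g := by rw [hB, ← hgb, sum_sq_toVec hgn]
  have hg0 : g ≠ 0 := by
    intro h0
    apply isNonsingular_lllReduce hI
    refine Matrix.det_eq_zero_of_row_eq_zero ⟨0, Nat.succ_pos m⟩ fun j => ?_
    have : b₁ j = 0 := by rw [← hgb, h0, toVec_apply, coeff_zero]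
    exact this
  constructor
  · -- (⇒) a factor of degree `≤ m` through `ū` is a short lattice vector
    rintro ⟨g₀, hg₀m, hg₀irr, ⟨w, hw⟩, hug₀, hg₀deg⟩
    have hg₀mod : ModDvd M u g₀ := cofactor g₀ w hw.symm hug₀
    have hg₀n : g₀.natDegree < m + 1 := Nat.lt_succ_of_le hg₀deg
    have hmem := mem_lattice_of_modDvd (m := M) hu hud hd (Nat.lt_succ_of_le hdm) hg₀n hg₀mod
    have hx0 : intVecToEuclidean (m + 1) (toVec (m + 1) g₀) ≠ 0 := by
      intro h0
      have : toVec (m + 1) g₀ = 0 := intVecToEuclidean_injective (m + 1) (by rw [h0, map_zero])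
      have : g₀ = 0 := by rw [← ofVec_toVec hg₀n, this]; simp [ofVec]
      exact hg₀m.ne_zero this
    have hfirst : ((∑ j, b₁ j ^ 2 : ℤ) : ℝ) ≤
        2 ^ (m + 1 - 1) * ‖intVecToEuclidean (m + 1) (toVec (m + 1) g₀)‖ ^ 2 :=
      sum_sq_first_row_le hI hIn hmem hx0
    rw [norm_sq_intVecToEuclidean', sum_sq_toVec hg₀n, Nat.add_sub_cancel] at hfirst
    -- Mignotte: `|g₀|² ≤ (m+1) 4^m |N|²`
    have hmig : sqNorm g₀ ≤ ((m : ℕ) + 1) * 4 ^ m * sqNorm N :=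
      sqNorm_le_of_dvd hN0 ⟨w, hw⟩ hg₀deg
    have hBle : (B : ℝ) ≤ degTestBound m (sqNorm N) := by
      have : (B : ℝ) ≤ 2 ^ m * (sqNorm g₀ : ℝ) := by exact_mod_cast hfirst
      refine this.trans ?_
      rw [degTestBound]
      push_cast
      gcongr
      exact_mod_cast hmig
    exact_mod_cast hBle
  · -- (⇐) a short first vector is divisible by `h₀`, so `deg h₀ ≤ m`
    intro hle
    have hN1 : N ≠ 1 := fun h => by rw [h, natDegree_one] at hND; omega
    obtain ⟨h₀, hh₀m, hh₀irr, ⟨w, hw⟩, huh₀⟩ :=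
      exists_monic_irreducible_factor_of_map_dvd hirr.prime D N hND.le hN hN1 hubarN
    refine ⟨h₀, hh₀m, hh₀irr, ⟨w, hw⟩, huh₀, ?_⟩
    have hh₀mod : ModDvd M u h₀ := cofactor h₀ w hw.symm huh₀
    have hh₀D : h₀.natDegree ≤ D := hND ▸ natDegree_le_of_dvd ⟨w, hw⟩ hN0
    have hgm : g.natDegree ≤ m := Nat.lt_succ_iff.1 hgn
    -- `|g|^{deg h₀} |h₀|^{deg g} < M`
    have hlt : rnorm g ^ h₀.natDegree * rnorm h₀ ^ g.natDegree < M := by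
      have hT1 : 1 ≤ degTestBound m (sqNorm N) := one_le_degTestBound m hS1
      have hC1 : (1 : ℤ) ≤ (D + 1) * 4 ^ D * sqNorm N := one_le_mignotteConst D hS1
      have hsqg : sqNorm g ≤ degTestBound m (sqNorm N) := hBg ▸ hle
      have hsqh : sqNorm h₀ ≤ (D + 1) * 4 ^ D * sqNorm N := by
        have := sqNorm_le_of_dvd hN0 ⟨w, hw⟩ hh₀D
        exact_mod_cast this
      have hA : sqNorm g ^ h₀.natDegree ≤ degTestBound m (sqNorm N) ^ D :=
        (pow_le_pow_left₀ (sqNorm_nonneg g) hsqg _).trans (pow_le_pow_right₀ hT1 hh₀D)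
      have hB' : sqNorm h₀ ^ g.natDegree ≤ ((D + 1) * 4 ^ D * sqNorm N) ^ m :=
        (pow_le_pow_left₀ (sqNorm_nonneg h₀) hsqh _).trans (pow_le_pow_right₀ hC1 hgm)
      have hZ : sqNorm g ^ h₀.natDegree * sqNorm h₀ ^ g.natDegree ≤ degPrecisionBound m D (sqNorm N) := by
        unfold degPrecisionBound
        exact mul_le_mul hA hB' (pow_nonneg (sqNorm_nonneg h₀) _)
          (pow_nonneg (degTestBound_nonneg m hS0) _)
      have h1 : (rnorm g ^ h₀.natDegree * rnorm h₀ ^ g.natDegree) ^ 2 ≤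
          (degPrecisionBound m D (sqNorm N) : ℝ) := by
        rw [mul_pow, ← pow_mul, ← pow_mul, mul_comm h₀.natDegree 2, mul_comm g.natDegree 2, pow_mul,
          pow_mul, rnorm_sq, rnorm_sq]
        exact_mod_cast hZ
      have h2 : (degPrecisionBound m D (sqNorm N) : ℝ) < (M : ℝ) ^ 2 := by exact_mod_cast hK
      exact lt_of_pow_lt_pow_left₀ 2 (by positivity) (h1.trans_lt h2)
    have := natDegree_le_of_irreducible_of_modDvd hM2 hh₀m hh₀irr hu hu0 hh₀mod hgmod hg0 hlt
    exact this.trans hgm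

/-! ### From `ℚ` to monic integer factors -/

/-- **Irreducible rational factors of a monic integer polynomial come from monic integer ones**
(Gauss's lemma): for `N ∈ ℤ[X]` monic, `N` has an irreducible factor over `ℚ` of degree `≤ m` iff it
has a monic irreducible factor in `ℤ[X]` of degree `≤ m`. [folklore] -/
theorem exists_irreducible_dvd_map_rat_iff {N : ℤ[X]} (hN : N.Monic) (m : ℕ) :
    (∃ g : ℚ[X], Irreducible g ∧ g ∣ N.map (Int.castRingHom ℚ) ∧ g.natDegree ≤ m) ↔
      ∃ g : ℤ[X], g.Monic ∧ Irreducible g ∧ g ∣ N ∧ g.natDegree ≤ m := by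
  set ψ := Int.castRingHom ℚ with hψ
  have hψi : Function.Injective ψ := Int.cast_injective
  have hψa : ψ = algebraMap ℤ ℚ := rfl
  constructor
  · -- descend along a factorisation of `N` into monic irreducibles
    suffices key : ∀ (n : ℕ) (N : ℤ[X]), N.natDegree ≤ n → N.Monic →
        ∀ g : ℚ[X], Irreducible g → g ∣ N.map ψ →
          ∃ h : ℤ[X], h.Monic ∧ Irreducible h ∧ h ∣ N ∧ h.natDegree = g.natDegree by
      rintro ⟨g, hgi, hgd, hgm⟩
      obtain ⟨h, hm, hi, hd, hdeg⟩ := key N.natDegree N le_rfl hN g hgi hgd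
      exact ⟨h, hm, hi, hd, hdeg ▸ hgm⟩
    intro n
    induction n with
    | zero =>
      intro N hNn hN g hgi hgd
      have h1 : N = 1 := eq_one_of_monic_natDegree_zero hN (Nat.le_zero.1 hNn)
      rw [h1, Polynomial.map_one] at hgd
      exact absurd (isUnit_of_dvd_one hgd) hgi.not_isUnit
    | succ n ih =>
      intro N hNn hN g hgi hgd
      have hgp : Prime g := hgi.prime
      by_cases hNirr : Irreducible N
      · have hNq : Irreducible (N.map ψ) := by
          rw [hψa]; exact (hN.irreducible_iff_irreducible_map_fraction_map).1 hNirr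
        have hass : Associated g (N.map ψ) := hgi.associated_of_dvd hNq hgd
        refine ⟨N, hN, hNirr, dvd_rfl, ?_⟩
        rw [← natDegree_map_eq_of_injective hψi N]
        exact (natDegree_eq_of_degree_eq (degree_eq_degree_of_associated hass)).symm
      · have hN1 : N ≠ 1 := by
          intro h1
          rw [h1, Polynomial.map_one] at hgd
          exact hgi.not_isUnit (isUnit_of_dvd_one hgd)
        rw [irreducible_of_monic hN hN1] at hNirr
        push Not at hNirr
        obtain ⟨a, b, ha, hb, hab, ha1, hb1⟩ := hNirr
        have hapos : 0 < a.natDegree := by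
          by_contra h0
          exact ha1 (eq_one_of_monic_natDegree_zero ha (Nat.le_zero.1 (not_lt.1 h0)))
        have hbpos : 0 < b.natDegree := by
          by_contra h0
          exact hb1 (eq_one_of_monic_natDegree_zero hb (Nat.le_zero.1 (not_lt.1 h0)))
        have hdeg : a.natDegree + b.natDegree = N.natDegree := by rw [← hab, ha.natDegree_mul hb]
        have hgab : g ∣ a.map ψ * b.map ψ := by rw [← Polynomial.map_mul, hab]; exact hgd
        rcases hgp.dvd_or_dvd hgab with h | h
        · obtain ⟨h₀, hm, hi, hd, hdg⟩ := ih a (by omega) ha g hgi h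
          exact ⟨h₀, hm, hi, hd.trans ⟨b, hab.symm⟩, hdg⟩
        · obtain ⟨h₀, hm, hi, hd, hdg⟩ := ih b (by omega) hb g hgi h
          exact ⟨h₀, hm, hi, hd.trans ⟨a, by rw [mul_comm, hab]⟩, hdg⟩
  · rintro ⟨g, hgm, hgi, hgd, hgdeg⟩
    refine ⟨g.map ψ, ?_, Polynomial.map_dvd ψ hgd, ?_⟩
    · rw [hψa]; exact (hgm.irreducible_iff_irreducible_map_fraction_map).1 hgi
    · rwa [natDegree_map_eq_of_injective hψi]

end LLLFactoring

end Literature.Computability.Complexity
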